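import Literature.AlgebraicGeometry.Frobenioids.ArchimedeanPerfectionRadialLevelEq
import Literature.AlgebraicGeometry.Frobenioids.ModelFrobenioidComparison
import HarnessLib

/-!
# Frobenioids II, Thm. 3.6 (i) at `Λ = ℚ`, piece P2 (iv): TRANSPORT of the radial germs along linear arrows of
# `C^ℚ = C^pf` (the naturality `(T-rad)` of the rational function monoid `≅ (Φ^fld)^Λ`)

Mochizuki, *The geometry of Frobenioids II: poly-Frobenioids*, Kyushu J. Math. **62** (2008) 401–460, §3,
Thm. 3.6 (i) p. 36 ("rational function monoid NATURALLY isomorphic to `(Φ^fld)^Λ`")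
[cite: MochizukiFrdII2008, Thm 3.6 (i) p.36]; [FrdI] Prop. 2.2 (ii)(a) p. 45 / Prop. 4.4 (iv) p. 83 (`O^×(−)` along
linear morphisms: `ψ ∘ u = v ∘ ψ` in `C^birat`) [cite: MochizukiFrdI2008, Prop. 4.4 (iv) p.83].

abc-iut cell, layer L1, row M13-c3 piece **P2** (seat abc-iut-w5-d246), file 2e of the P2 chain = the input
`(T-rad)` of abc-iut-L1-t6's `Thm36Sub.istrModel_Q_of_section`: for a LINEAR arrow `ψ : (A, n) → (A′, n′)` of
`C^pf` and `a ∈ ℝ_{≥0}`, the radial germs `σ₀_X(a)` and `σ₀_{X′}(a)` are intertwined along `ψ`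
(**`intertwines_radialSection`**).  Proof: represent `ψ` at a level `(a, b)` (`n a = n′ b`) with `A^{(a)}`,
`A′^{(b)}` naively isotropic; by level independence (file 2d) both radial sections may be computed at these levels,
where they are the germs of the SAME positive real scalar `r = e^{−(n a)·a}`; the square
"`ψ₀|_discs ≫ ι′_r = ι_r ≫ ψ₀`" of `C` (positive reals are Galois-fixed; `ψ₀` linear) then exhibits the
intertwining at the triple level `(1, a, b)`.  One plumbing def (`crossDisc`); nothing here bears on [IUTchIII]
Cor. 3.12.
-/

noncomputable section

namespace Literature.AlgebraicGeometry.Frobenioids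

open CategoryTheory Opposite
open scoped Pointwise NNReal

universe v u

namespace ArchFrd

namespace Thm36Sub

variable {D : Type u} [Category.{v} D] {π : D ⥤ D0}

open PreFrobenioid PreFrobenioid.Perfection

/-! ### Multiples of isotropic levels are isotropic -/

/-- If `A^{(c)}` is naively isotropic then so is `A^{(c·m)}` (target of the transition arrow `A^{(c)} → A^{(c m)}`
out of an object with all directions; `S¹` is divisible). [cite: MochizukiFrdII2008, Lem 3.2 (v) p.25] -/
theorem isNaivelyIsotropic_frobPow_mul {hF : PreFrobenioid.IsFrobenioid (C.toElem π)} (X : pfCat π hF) {c : ℕ+}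
    (hc : (frobPow hF X.obj c).fst.IsNaivelyIsotropic) (m : ℕ+) :
    (frobPow hF X.obj (c * m)).fst.IsNaivelyIsotropic :=
  C0.isNaivelyIsotropic_of_hom_of_pow_surj (frobTrans hF X.obj (dvd_mul_right c m)).fst fun w => by
    obtain ⟨z, hz⟩ := normOne_exists_pow_eq w (C0.degFr (frobTrans hF X.obj (dvd_mul_right c m)).fst)
    refine ⟨z, ?_, hz⟩
    rw [show (frobPow hF X.obj c).fst.region.dir = Set.univ from hc]
    exact Set.mem_univ _

/-! ### A linear arrow of `C` restricted to discs -/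

section Cross

variable {B B' : C π} (ψ₀ : B ⟶ B') (hB : B.fst.IsNaivelyIsotropic) (hB' : B'.fst.IsNaivelyIsotropic)

/-- **`ψ₀` restricted to discs**: the arrow `disc_t(B) → disc_{t′}(B′)` of `C` with the base, scalar and
`D`-component of `ψ₀` and degree `1` (for `|scalar ψ₀| · t ≤ t′`). [cite: MochizukiFrdII2008, Ex 3.3 (i) p.27] -/
def crossDisc (t t' : PosReal) (h : ‖(C0.scalar ψ₀.fst : ℂ)‖ * t ≤ t') : disc B t ⟶ disc B' t' where
  fst :=
    { base := (C0.Base ψ₀.fst :)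
      degFr := 1
      scalar := C0.scalar ψ₀.fst
      scalar_mem := ψ₀.fst.scalar_mem
      mapsTo := by
        rw [PNat.one_coe, pow_one]
        rintro _ ⟨u, hu, rfl⟩
        rw [C0.mem_carrier_of_isIsotropic (AngularRegion.isIsotropic_isotropicOfTip t), ← Subtype.coe_le_coe,
          coe_absHom] at hu
        refine ⟨(C0.Base ψ₀.fst :).act (C0.scalar ψ₀.fst * u), ?_, D0.galAct_galAct _ _⟩
        rw [C0.mem_carrier_of_isIsotropic (AngularRegion.isIsotropic_isotropicOfTip t'), ← Subtype.coe_le_coe,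
          coe_absHom, D0.norm_galAct, Units.val_mul, norm_mul]
        exact (mul_le_mul_of_nonneg_left hu (norm_nonneg _)).trans h }
  snd := ψ₀.snd
  w := ψ₀.w

/-- `Base` of `ψ₀|_discs`. [cite: MochizukiFrdII2008, Ex 3.3 (i) p.27] -/
theorem base_crossDisc (t t' : PosReal) (h : ‖(C0.scalar ψ₀.fst : ℂ)‖ * t ≤ t') :
    C0.Base (crossDisc ψ₀ t t' h).fst = (C0.Base ψ₀.fst :) := rfl

/-- Scalar of `ψ₀|_discs`. [cite: MochizukiFrdII2008, Ex 3.3 (i) p.27] -/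
theorem scalar_crossDisc (t t' : PosReal) (h : ‖(C0.scalar ψ₀.fst : ℂ)‖ * t ≤ t') :
    C0.scalar (crossDisc ψ₀ t t' h).fst = C0.scalar ψ₀.fst := rfl

/-- `deg_Fr (ψ₀|_discs) = 1`. [cite: MochizukiFrdII2008, Ex 3.3 (i) p.27] -/
theorem degFr_crossDisc (t t' : PosReal) (h : ‖(C0.scalar ψ₀.fst : ℂ)‖ * t ≤ t') :
    C0.degFr (crossDisc ψ₀ t t' h).fst = 1 := rfl

/-- `D`-component of `ψ₀|_discs`. [cite: MochizukiFrdII2008, Ex 3.3 (i) p.27] -/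
theorem crossDisc_snd (t t' : PosReal) (h : ‖(C0.scalar ψ₀.fst : ℂ)‖ * t ≤ t') :
    (crossDisc ψ₀ t t' h).snd = ψ₀.snd := rfl

/-- **The transport square in `C`**: `ψ₀|_discs ≫ ι′_r = ι_r ≫ ψ₀` for a positive real scalar `r` and `ψ₀`
linear (positive reals are fixed by the Galois twist of `Base ψ₀`). [cite: MochizukiFrdI2008, Prop. 4.4 (iv) p.83] -/
theorem crossDisc_comp_discIncl (hψ₀ : C0.degFr ψ₀.fst = 1) (t t' : PosReal)
    (h : ‖(C0.scalar ψ₀.fst : ℂ)‖ * t ≤ t') (r : PosReal) (hr : ‖((ofPosReal ℂ r : ℂˣ) : ℂ)‖ * t ≤ B.fst.tip)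
    (hr' : ‖((ofPosReal ℂ r : ℂˣ) : ℂ)‖ * t' ≤ B'.fst.tip) :
    crossDisc ψ₀ t t' h ≫ discIncl B' hB' t' (ofPosReal ℂ r) (ofPosReal_mem_scalars _ _) hr' =
      discIncl B hB t (ofPosReal ℂ r) (ofPosReal_mem_scalars _ _) hr ≫ ψ₀ := by
  refine CFP.hom_ext (C0.hom_ext ?_ ?_ ?_) ?_
  · rw [CFP.comp_fst, CFP.comp_fst, C0.base_comp', C0.base_comp', base_discIncl, base_discIncl, base_crossDisc]
    exact (Category.comp_id _).trans (Category.id_comp _).symm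
  · rw [CFP.comp_fst, CFP.comp_fst, C0.degFr_comp', C0.degFr_comp', degFr_discIncl, degFr_discIncl, degFr_crossDisc, hψ₀]
  · rw [CFP.comp_fst, CFP.comp_fst, C0.scalar_comp', C0.scalar_comp', scalar_discIncl, scalar_discIncl,
      degFr_discIncl, base_discIncl, base_crossDisc, scalar_crossDisc, hψ₀, PNat.one_coe, pow_one, pow_one,
      D0.Hom.act, D0.Hom.act, D0.twists_id, D0.galAct_false,
      D0.galAct_eq_self_of_mem_scalars_real _ (ofPosReal_mem_scalars r D0.real), mul_comm]
  · rw [CFP.comp_snd, CFP.comp_snd, discIncl_snd, discIncl_snd, crossDisc_snd]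
    exact (Category.comp_id _).trans (Category.id_comp _).symm

end Cross

/-! ### The transport square in `C^pf` at adapted levels -/

section Pf

variable {hF : PreFrobenioid.IsFrobenioid (C.toElem π)} (X X' : pfCat π hF)
  (hPf : PreFrobenioid.IsFrobenioid (pfStr π hF)) {a b : ℕ+} (e : X.idx * a = X'.idx * b)
  (hc : (frobPow hF X.obj a).fst.IsNaivelyIsotropic) (hc' : (frobPow hF X'.obj b).fst.IsNaivelyIsotropic)

/-- The arrow `(disc_t over A^{(a)}, n a) → (disc_{t′} over A′^{(b)}, n′ b)` of `C^pf` induced at level `(1, 1)` by an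
arrow `j` of `C` between the discs (`n a = n′ b`). [cite: MochizukiFrdI2008, Def. 3.1 (iii) p.57] -/
def crossPf {t t' : PosReal} (j : disc (frobPow hF X.obj a) t ⟶ disc (frobPow hF X'.obj b) t') :
    discPf X a t ⟶ discPf X' b t' :=
  Hom.mk ⟨⟨1, 1, by change X.idx * a * 1 = X'.idx * b * 1; rw [mul_one, mul_one, e]⟩,
    frobOneInv (disc (frobPow hF X.obj a) t) ≫ j ≫ frob hF (disc (frobPow hF X'.obj b) t') 1⟩

omit hc hc' in
/-- `crossPf j ≫ ι′-arrow = [frob⁻¹ ≫ j ≫ ι′]` at level `(1, b)`. [cite: MochizukiFrdI2008, Def. 3.1 (iii) p.57] -/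
theorem crossPf_comp_inclHom {t t' : PosReal} (j : disc (frobPow hF X.obj a) t ⟶ disc (frobPow hF X'.obj b) t')
    (ι' : disc (frobPow hF X'.obj b) t' ⟶ frobPow hF X'.obj b) :
    crossPf X X' e j ≫ inclHom X' b t' ι' =
      Hom.mk (⟨⟨1, b, by change X.idx * a * 1 = X'.idx * b; rw [mul_one, e]⟩,
        frobOneInv (disc (frobPow hF X.obj a) t) ≫ j ≫ ι'⟩ : Rep (discPf X a t) X') := by
  let T : Level₃ (discPf X a t) (discPf X' b t') X' :=
    ⟨1, 1, b, by change X.idx * a * 1 = X'.idx * b * 1; rw [mul_one, mul_one, e], mul_one _⟩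
  rw [crossPf, inclHom, Perfection.mk_comp_mk, ← Perfection.mk_compAt T _ _ (Level.le_rfl _) (Level.le_rfl _)]
  refine Perfection.Hom.mk_eq_mk.mpr ⟨T.out, Level.le_rfl _, Level.le_rfl _, ?_⟩
  unfold compAt inclRep
  change Level.lift (⟨1, b, _⟩ : Level (discPf X a t) X') ⟨1, b, _⟩ (Level.le_rfl _)
      (Level.lift (⟨1, 1, _⟩ : Level (discPf X a t) (discPf X' b t')) ⟨1, 1, _⟩ (Level.le_rfl _)
          (frobOneInv (disc (frobPow hF X.obj a) t) ≫ j ≫ frob hF (disc (frobPow hF X'.obj b) t') 1) ≫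
        Level.lift (⟨1, b, mul_one _⟩ : Level (discPf X' b t') X') ⟨1, b, mul_one _⟩ (Level.le_rfl _)
          (frobOneInv (disc (frobPow hF X'.obj b) t') ≫ ι')) =
    Level.lift (⟨1, b, _⟩ : Level (discPf X a t) X') ⟨1, b, _⟩ (Level.le_rfl _)
      (frobOneInv (disc (frobPow hF X.obj a) t) ≫ j ≫ ι')
  rw [Level.lift_rfl, Level.lift_rfl, Level.lift_rfl, Level.lift_rfl]
  simp only [Category.assoc, frob_frobOneInv_assoc]

omit hc hc' in
/-- `ι-arrow ≫ [ψ₀] = [(frob⁻¹ ≫ ι) ≫ ψ₀]` at level `(1, b)` (composition at the triple level `(1, a, b)`, no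
transition maps). [cite: MochizukiFrdI2008, Def. 3.1 (iii) p.57] -/
theorem inclHom_comp_mk {t : PosReal} (ι : disc (frobPow hF X.obj a) t ⟶ frobPow hF X.obj a)
    (ψ₀ : frobPow hF X.obj a ⟶ frobPow hF X'.obj b) :
    inclHom X a t ι ≫ Hom.mk (⟨⟨a, b, e⟩, ψ₀⟩ : Rep X X') =
      Hom.mk (⟨⟨1, b, by change X.idx * a * 1 = X'.idx * b; rw [mul_one, e]⟩,
        (frobOneInv (disc (frobPow hF X.obj a) t) ≫ ι) ≫ ψ₀⟩ : Rep (discPf X a t) X') := by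
  let T : Level₃ (discPf X a t) X X' := ⟨1, a, b, mul_one _, e⟩
  rw [inclHom, Perfection.mk_comp_mk, ← Perfection.mk_compAt T _ _ (Level.le_rfl _) (Level.le_rfl _)]
  refine Perfection.Hom.mk_eq_mk.mpr ⟨T.out, Level.le_rfl _, Level.le_rfl _, ?_⟩
  unfold compAt inclRep
  change Level.lift (⟨1, b, _⟩ : Level (discPf X a t) X') ⟨1, b, _⟩ (Level.le_rfl _)
      (Level.lift (⟨1, a, mul_one _⟩ : Level (discPf X a t) X) ⟨1, a, mul_one _⟩ (Level.le_rfl _)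
          (frobOneInv (disc (frobPow hF X.obj a) t) ≫ ι) ≫
        Level.lift (⟨a, b, e⟩ : Level X X') ⟨a, b, e⟩ (Level.le_rfl _) ψ₀) =
    Level.lift (⟨1, b, _⟩ : Level (discPf X a t) X') ⟨1, b, _⟩ (Level.le_rfl _)
      ((frobOneInv (disc (frobPow hF X.obj a) t) ≫ ι) ≫ ψ₀)
  rw [Level.lift_rfl, Level.lift_rfl, Level.lift_rfl, Level.lift_rfl]

/-- **Transport of radial germs at adapted levels**: for `ψ = [ψ₀]`, `ψ₀ : A^{(a)} → A′^{(b)}` linear, `n a = n′ b`,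
both levels naively isotropic, and a positive real `r`, the germs of scalar `r` at `(A, n)` (level `a`) and at
`(A′, n′)` (level `b`) satisfy `ψ ∘ germ = germ′ ∘ ψ` in `C^birat` (the square `ψ₀|_discs ≫ ι′ = ι ≫ ψ₀`).
[cite: MochizukiFrdI2008, Prop. 4.4 (iv) p.83] -/
theorem intertwines_germ (ψ₀ : frobPow hF X.obj a ⟶ frobPow hF X'.obj b) (hψ₀ : C0.degFr ψ₀.fst = 1) (r : PosReal) :
    BiratUnits.Intertwines hPf (Hom.mk (⟨⟨a, b, e⟩, ψ₀⟩ : Rep X X'))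
      (germ X hPf hc (ofPosReal ℂ r) (ofPosReal_mem_scalars _ _))
      (germ X' hPf hc' (ofPosReal ℂ r) (ofPosReal_mem_scalars _ _)) := by
  -- radii: `t′` = the standard radius at `A′^{(b)}`, `t` small enough at `A^{(a)}` and for `ψ₀|_discs`
  let t' : PosReal := rad (frobPow hF X'.obj b) (ofPosReal ℂ r)
  let t₁ : PosReal := rad (frobPow hF X.obj a) (ofPosReal ℂ r)
  let t₂ : PosReal := rad (disc (frobPow hF X'.obj b) t') (C0.scalar ψ₀.fst)
  let t : PosReal := ⟨min (t₁ : ℝ) (t₂ : ℝ), lt_min t₁.2 t₂.2⟩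
  have h1 : (t : ℝ) ≤ t₁ := min_le_left _ _
  have h2 : (t : ℝ) ≤ t₂ := min_le_right _ _
  have ht : (t : ℝ) ≤ (frobPow hF X.obj a).fst.tip := h1.trans (rad_le _ _)
  have hr : ‖((ofPosReal ℂ r : ℂˣ) : ℂ)‖ * t ≤ (frobPow hF X.obj a).fst.tip :=
    (mul_le_mul_of_nonneg_left h1 (norm_nonneg _)).trans (norm_mul_rad_le _ _)
  have h : ‖(C0.scalar ψ₀.fst : ℂ)‖ * t ≤ t' :=
    (mul_le_mul_of_nonneg_left h2 (norm_nonneg _)).trans (norm_mul_rad_le _ _)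
  have ht' : (t' : ℝ) ≤ (frobPow hF X'.obj b).fst.tip := rad_le _ _
  have hr' : ‖((ofPosReal ℂ r : ℂˣ) : ℂ)‖ * t' ≤ (frobPow hF X'.obj b).fst.tip := norm_mul_rad_le _ _
  have h1r : ‖((ofPosReal ℂ (1 : PosReal) : ℂˣ) : ℂ)‖ * t ≤ (frobPow hF X.obj a).fst.tip := by
    rw [map_one]; exact norm_one_mul_le ht
  have h1r' : ‖((ofPosReal ℂ (1 : PosReal) : ℂˣ) : ℂ)‖ * t' ≤ (frobPow hF X'.obj b).fst.tip := by
    rw [map_one]; exact norm_one_mul_le ht'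
  rw [germ_eq_mk_stdFrac X hPf hc (ofPosReal ℂ r) _ t ht hr]
  refine ⟨stdFrac X a hc t ht (ofPosReal ℂ r) (ofPosReal_mem_scalars _ _) hr,
    stdFrac X' b hc' t' ht' (ofPosReal ℂ r) (ofPosReal_mem_scalars _ _) hr', discPf X a t, 𝟙 _,
    crossPf X X' e (crossDisc ψ₀ t t' h), rfl, rfl, isCoAngularPreStep_id hPf _, ?_, ?_⟩
  · -- denominators: scalar `1 = ofPosReal 1`
    change crossPf X X' e (crossDisc ψ₀ t t' h) ≫ inclHom X' b t' (discIncl _ hc' t' 1 _ _) =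
      𝟙 _ ≫ inclHom X a t (discIncl _ hc t 1 _ _) ≫ Hom.mk ⟨⟨a, b, e⟩, ψ₀⟩
    have e1 := crossDisc_comp_discIncl ψ₀ hc hc' hψ₀ t t' h 1 h1r h1r'
    rw [Category.id_comp, crossPf_comp_inclHom, inclHom_comp_mk, Category.assoc,
      discIncl_congr (hB := hc') (hB' := hc') (t := t') (hz' := ofPosReal_mem_scalars _ _) (h' := h1r')
        (map_one (ofPosReal ℂ)).symm,
      discIncl_congr (hB := hc) (hB' := hc) (t := t) (hz' := ofPosReal_mem_scalars _ _) (h' := h1r)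
        (map_one (ofPosReal ℂ)).symm, e1]
  · change crossPf X X' e (crossDisc ψ₀ t t' h) ≫ inclHom X' b t' (discIncl _ hc' t' (ofPosReal ℂ r) _ _) =
      𝟙 _ ≫ inclHom X a t (discIncl _ hc t (ofPosReal ℂ r) _ _) ≫ Hom.mk ⟨⟨a, b, e⟩, ψ₀⟩
    rw [Category.id_comp, crossPf_comp_inclHom, inclHom_comp_mk, Category.assoc,
      crossDisc_comp_discIncl ψ₀ hc hc' hψ₀ t t' h r hr hr']

end Pf

/-! ### `(T-rad)`: the radial sections are intertwined along every linear arrow -/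

/-- **`(T-rad)` — transport of the radial section along linear arrows of `C^pf`**: for `ψ : (A, n) → (A′, n′)`
linear and `a ∈ ℝ_{≥0}`, `ψ ∘ σ₀_X(a) = σ₀_{X′}(a) ∘ ψ` in `C^birat` (`BiratUnits.Intertwines`), for the radial
sections at ANY naively isotropic levels `c`, `c′` ([FrdII] Thm. 3.6 (i): the isomorphism with `(Φ^fld)^Λ` is
natural; the `Φ^gp`-coordinate pulls back identically along `Base ψ`). [cite: MochizukiFrdII2008, Thm 3.6 (i) p.36] -/
theorem intertwines_radialSection {hF : PreFrobenioid.IsFrobenioid (C.toElem π)} {X X' : pfCat π hF}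
    (hPf : PreFrobenioid.IsFrobenioid (pfStr π hF)) (ψ : X ⟶ X') (hψ : IsLinear (pfStr π hF) ψ) {c c' : ℕ+}
    (hc : (frobPow hF X.obj c).fst.IsNaivelyIsotropic) (hc' : (frobPow hF X'.obj c').fst.IsNaivelyIsotropic)
    (x : Multiplicative ℝ≥0) :
    BiratUnits.Intertwines hPf ψ (radialSection X hPf hc x) (radialSection X' hPf hc' x) := by
  obtain ⟨⟨⟨a₀, b₀, e₀⟩, ψ₀⟩, rfl⟩ := exists_rep ψ
  -- adapted isotropic levels `a = c·(a₀ c′)`, `b = c′·(b₀ c)`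
  have ha := isNaivelyIsotropic_frobPow_mul X hc (a₀ * c')
  have hb := isNaivelyIsotropic_frobPow_mul X' hc' (b₀ * c)
  have e : X.idx * (c * (a₀ * c')) = X'.idx * (c' * (b₀ * c)) := by
    rw [mul_left_comm c a₀ c', ← mul_assoc, e₀, mul_assoc, mul_left_comm c' b₀ c, mul_comm c c']
  have hle : (⟨a₀, b₀, e₀⟩ : Level X X').LE ⟨c * (a₀ * c'), c' * (b₀ * c), e⟩ :=
    ⟨dvd_mul_of_dvd_right (dvd_mul_right a₀ c') c, dvd_mul_of_dvd_right (dvd_mul_right b₀ c) c'⟩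
  rw [← radialSection_mul_eq X hPf hc ha, ← radialSection_mul_eq X' hPf hc' hb,
    ← Hom.mk_lift ⟨⟨a₀, b₀, e₀⟩, ψ₀⟩ ⟨c * (a₀ * c'), c' * (b₀ * c), e⟩ hle, radialSection_apply, radialSection_apply]
  -- the two radial scalars are the same positive real (`n a = n′ b`)
  have hρ : radialScalar X' (c := c' * (b₀ * c)) x = radialScalar X (c := c * (a₀ * c')) x := by
    apply Subtype.ext
    change Real.exp _ = Real.exp _
    rw [show ((X'.idx * (c' * (b₀ * c)) : ℕ+) : ℕ) = ((X.idx * (c * (a₀ * c')) : ℕ+) : ℕ) by rw [e]]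
  rw [germ_congr X' hPf hb (congrArg (ofPosReal ℂ) hρ) _ (ofPosReal_mem_scalars _ _)]
  -- linearity of the lifted representative
  have hlin : C0.degFr (Level.lift (⟨a₀, b₀, e₀⟩ : Level X X') ⟨c * (a₀ * c'), c' * (b₀ * c), e⟩ hle ψ₀).fst = 1 := by
    have h1 : Rep.degFr (⟨⟨a₀, b₀, e₀⟩, ψ₀⟩ : Rep X X') = 1 := hψ
    have := degFr_lift (⟨a₀, b₀, e₀⟩ : Level X X') ⟨c * (a₀ * c'), c' * (b₀ * c), e⟩ hle ψ₀
    rw [h1] at this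
    exact this
  exact intertwines_germ X X' hPf e ha hb _ hlin _

end Thm36Sub

end ArchFrd

end Literature.AlgebraicGeometry.Frobenioids

end
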